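import Summits.QuantumFields.BalabanUV.Beta.WardLocusRecursiveLettersSlot
import Summits.QuantumFields.BalabanUV.Beta.KernelWardRelativeEnd

/-!
# `BalabanUV.Beta.WardLocusRecursiveZeroSlot` — row D1 ∕ (C1), PART 112: THE MEMBER-0 CUT OF an2 g29's SLOT-GENERIC SECOND-ORDER WARD CHAIN — the Ward kernel law of
# `WrecOf G (SpureRecOf V H G) M … 0` with a CLASSIFIED, ROW-PARITY-ODD residual from the LEVEL-0 letters and the LEVEL-0 resolvent sockets ONLY, and its
# re-spelling in the coarse Ward END's exact W-side socket text (`hWd` with `X₂ := 0`, `hNr`, `hN0`)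

HONEST DEPENDENCY (page 1, mandatory): continuum YM on T⁴ ⇐ BetaPertH ∧ nine spine estimates (0/9 proved); BetaPertH ⇐ (D1) ∧ (D4) ∧ CAP+tail;
G-an2-4 gates asym, D1 and NE2/3/4.  HONEST FRAMING (cell contract, verbatim): «discharging `BetaPertH` makes Bałaban's UV stability UNCONDITIONAL —
a real constructive-QFT result; it is NOT the continuum limit and NOT the Clay problem.»  ABSOLUTE RULE (cell charter, verbatim): «No internally-minted
statement may enter as a cited fact. Every hypothesis is either kernel-proved in this package or a verbatim quotation of a PUBLISHED theorem with page
reference. The manuscript(s) under audit are NOT citable for their own disputed steps — they are the thing under adjudication; programme-internal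
(2001/route/tribunal) claims are never citable.»

WHY (an2 gen 87; HWD-SCOPING §0 ∕ §1b (ii) ∕ §2 item 4).  The `hW𝒯 j` END of the N-system (PART 103 `FP/TowerNWardOfTableLaws.wardTransversal_AN_of_tableLaws`)
displays, on its W-side, `hWd : divW W y ν y′ = conjW M 0 (vertexOfK K N S ν y′) (X y) 0 (X₂ y ν y′) + Nr y ν y′`, `hNr : Loc (Nr …)`, `hN0 : tadpole K (Nr …) = 0`,
where the record's `W` is MEMBER 0 of a slotted W-family `WrecOf d N (fun _ ↦ K) (SpureRecOf …) M cE₂ cB T vh₂S mixFF 0` (`JNat_W`, `WchartOf_eq`).  an2 g29's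
`WardLocusRecursiveLettersSlot.exists_kernelLaws_of_letters_slot` produces (class ∧ parity ∧ law) at EVERY level by one induction — but asks for the resolvent
sockets, the first-order law `hD`, the border∕mixed letters and the locks at EVERY level, which the N-system's composite triple has only at member 0 (PART 102∕104∕
107∕108: `relInv_AN`, `colH_ward_AN`, `colM_ward_AN`, `AN_inr_inr_off`, `sSide_of_borderLaw`, `divV_dM_AN_compVhS_rooted`; PART 106c∕110g∕111: the letters).
THIS FILE is the member-0 cut: §1 **`exists_kernelLaw_zero_of_letters_slot`** — from the slots' letters (LV)(LH)(DG)(LM)∕`hB`∕`hmix`, the LEVEL-0 sockets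
(`Spr 𝕄`, `Spr E`, `RelInv (G 0) 𝕄 E`, ℋ-column Ward `cH`, multiplier-column Ward null, off-lattice vanishing, `[E, X y] = 0`, first-order law `hD` of
`dM (G 0) … (M 0)`), the row parities of `SpureRecOf … 0` and `M 0`, and the three level-0 letters (Wilson, border, mixed — both slots where slotted) with their
remainders' classes (one rate) and row parities, there is `Nr` with `∀ y, VertexFamily (Nr y) Lc C δ` (one `C`, `δ > 0`), `trK (Nr y ν y′) = −sgnK (Nr y ν y′)` and
`divW (WrecOf … 0) y ν y′ = conjV (dM (G 0) Lc (SpureRecOf … 0) (M 0) ν y′) (X y) + Nr y ν y′` (parts B `divW_WrecOf_of_tableLaws`, A `tableLaw_T2RecOf_zero[″]`,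
Q `exists_vertexFamily_residual_slot` ∕ `parityOdd_residual_slot` — the `zero` branch of g29's induction, nothing else); §2 **`exists_wardSide_zero_of_letters_slot`**
— with the order-one consistency (c1) at member 0 and the sgn-symmetry of `G 0`, the same in the coarse Ward END's EXACT W-side text: `∃ Nr`, `Loc`, `tadpole (G 0) (Nr …)
= 0` (an1 `KernelWardRelativeEnd.tadpole_eq_zero_of_parity`), parity, and `divW (WrecOf … 0) y ν y′ = conjW 𝕄 0 (vertexOfK (G 0) Lc (SrecOf … 0) ν y′) (X y) 0 0 + Nr y ν y′`
(`WardLocusRecursiveStep.conjW_zero_zero_zero`; `X₂ := 0`, whose `hX₂`∕`hEX₂` are `loc_zero`∕`rfl` at the consumer).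

WHAT: [folklore] composition BY NAME of g29's parts A∕B∕Q and an1's parity lemma; generic `d`, generic slots; no `def`, no `def … : Prop`, nothing cited, 0 sorry.
Nothing of Bałaban's asserted, valued or discharged; 0 estimates; 0∕4 row-D1 binders; (W)_j NOT claimed (the record-level instantiation at the composite triple —
`W = WrecOf … 0`, `S = SrecOf … 0`, (c1) for `AN` — is (O3)-class, referee-gated); NOT (C1), NOT D1, NEVER «G-an2-4 closed», NOT BetaPertH, NOT continuum, NOT Clay.
Row D1 ∕ (C1) OWNER «beta-an2», gen 87, 2026-08-30.  No existing file touched.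
-/

noncomputable section

open Finset
open scoped BigOperators
open Literature.MathematicalPhysics.QuantumFieldTheory
open Literature.MathematicalPhysics.QuantumFieldTheory.Balaban1983to89
open Literature.MathematicalPhysics.QuantumFieldTheory.Balaban1983to89.Beta
open B6BondElimination (unitVec)
open ExpKernelCalculus (MKer Decays BiLoc VertexFamily comp tadpole)
open KernelWard (divV divW bdd_of_biLoc)
open AffineAveraging (Site box toSite)
open OneStepResolventKernel (Fib wsum LocStencil)
open OneStepKernelFamily (colH vertexOfK)
open InterLevelTransport (cwsum)
open SecondOrderResponse (colM vertexOfM dM LocStencilFM)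
open BalabanCompositeJets (LocStencil₂)
open BalabanStepW2 (M2Of)
open StepJetData (wilsonA locStencil_add)
open WilsonBiStencil (wilsonW₂)
open Summit.QuantumFields.BalabanUV.Beta.TameKernelCalculus
open Summit.QuantumFields.BalabanUV.Beta.ChartConjugation (conjV conjW)
open Summit.QuantumFields.BalabanUV.Beta.ChartConjugationRelative (RelInv)
open Summit.QuantumFields.BalabanUV.Beta.BorderedHessian (diagK sgnK)
open Summit.QuantumFields.BalabanUV.Beta.AveragingWardRootedStencils (legInd)
open Summit.QuantumFields.BalabanUV.Beta.SpineRooted (SpureRecOf T2RecOf WrecOf locStencil_SpureRecOf)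
open Summit.QuantumFields.BalabanUV.Beta.WardLocusRecursive (SrecOf)
open Summit.QuantumFields.BalabanUV.Beta.KernelWardRelative (gaugeWt)
open Summit.QuantumFields.BalabanUV.Beta.KernelWardLevels (loc_diagK_smul_sum_legInd)
open Summit.QuantumFields.BalabanUV.Beta.BubbleParity (spr_of_decays)
open Summit.QuantumFields.BalabanUV.Beta.KernelWardRemainderParity (parityOdd_add)
open Summit.QuantumFields.BalabanUV.Beta.KernelWardRelativeEnd (tadpole_eq_zero_of_parity)
open Summit.QuantumFields.BalabanUV.Beta.WardLocusRecursiveAll (abs_add_le')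
open Summit.QuantumFields.BalabanUV.Beta.WardLocusQuarticTableSlot (tableLaw_T2RecOf_zero tableLaw_T2RecOf_zero'')
open Summit.QuantumFields.BalabanUV.Beta.WardLocusRecursiveStep (conjW_zero_zero_zero)
open Summit.QuantumFields.BalabanUV.Beta.WardLocusRecursiveStepSlot (divW_WrecOf_of_tableLaws)
open Summit.QuantumFields.BalabanUV.Beta.WardLocusRecursiveAllSlot (spr_blockGen)
open Summit.QuantumFields.BalabanUV.Beta.WardLocusResidualSlot (exists_vertexFamily_residual_slot parityOdd_residual_slot)

namespace Summit.QuantumFields.BalabanUV.Beta.WardLocusRecursiveZeroSlot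

section Slot

variable {d Lc : ℕ} [NeZero Lc]
variable {V H : Fin (d + 1) → (Fin (d + 1) → ℤ) → MKer (d + 1) (Fib d)} {G : ℕ → MKer (d + 1) (Fib d)}
  {M : ℕ → Fin (d + 1) → (Fin (d + 1) → ℤ) → MKer (d + 1) (Fib d)}

/-! ## §1 Member 0: the kernel law with a classified, parity-odd residual, from the level-0 letters and sockets only -/

/-- [folklore] **THE WARD KERNEL LAW OF MEMBER 0 OF THE SLOTTED W-TABLES, WITH A CLASSIFIED ROW-PARITY-ODD RESIDUAL, FROM THE LEVEL-0 LETTERS** (root `toSite r`,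
generator `X y = diagK (ξ • Σ_v legInd (toSite r) (Lc•y+v))`, constant `cH`, generic pins `cE cVH cΛ cE₂ cB`).  The member-0 cut of g29's
`exists_kernelLaws_of_letters_slot`: ONLY the level-0 resolvent sockets (`𝕄`, `E`, `RelInv (G 0) 𝕄 E`, `hHc`, `hMw`, `hoff`, `hEX`, `hD`), the row parities of
`SpureRecOf … 0` and `M 0`, and the level-0 letters (Wilson `hWil hWil″`, border `hBord hBord″`, mixed `hM₂`) with their remainders' classes (one rate) and row
parities are displayed; the chart family `G` and the multiplier family `M` enter at the other levels only through the slots' class letters `hG`, `hM`. -/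
theorem exists_kernelLaw_zero_of_letters_slot (hLc : 1 ≤ Lc) (hV : ∀ δ : ℝ, 0 ≤ δ → ∃ C : ℝ, LocStencil V C δ)
    (hH : ∀ δ : ℝ, 0 ≤ δ → ∃ C : ℝ, VertexFamily H Lc C δ)
    (hG : ∀ j : ℕ, ∃ δ C : ℝ, 0 < δ ∧ 0 ≤ C ∧ Decays (G j) C δ) (hM : ∀ j : ℕ, ∃ CM δ : ℝ, 0 < δ ∧ VertexFamily (M j) Lc CM δ)
    (cE cVH cΛ cE₂ cB : ℝ) (T : Fin 4 → Fin 4 → Fin 4 → Fin 4 → ℝ)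
    {vh₂S : Fin (d + 1) → (Fin (d + 1) → ℤ) → Fin (d + 1) → (Fin (d + 1) → ℤ) → MKer (d + 1) (Fib d)}
    (hB : ∃ C δ : ℝ, 0 < δ ∧ LocStencil₂ vh₂S C δ)
    {mixFF : Fin (d + 1) → (Fin (d + 1) → ℤ) → Fin (d + 1) → (Fin (d + 1) → ℤ) → MKer (d + 1) (Fib d)}
    (hmix : ∃ C δ : ℝ, 0 < δ ∧ LocStencilFM Lc mixFF C δ)
    -- the LEVEL-0 resolvent sockets
    {𝕄 E : MKer (d + 1) (Fib d)} (h𝕄 : Spr 𝕄) (hE : Spr E) (hR : RelInv (G 0) 𝕄 E) (cH : ℝ)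
    (hHc : ∀ (y : Fin (d + 1) → ℤ) (κ' : Fin (d + 1)) (u : Fin (d + 1) → ℤ),
      ∑ μ, (colH (G 0) Lc μ (y - unitVec μ) κ' u - colH (G 0) Lc μ y κ' u) = cH * gaugeWt Lc y κ' u)
    (hMw : ∀ (y : Fin (d + 1) → ℤ) (ρ : Fin (d + 1)) (w : Fin (d + 1) → ℤ),
      ∑ μ, (colM (G 0) Lc μ (y - unitVec μ) ρ w - colM (G 0) Lc μ y ρ w) = 0)
    (hoff : ∀ (x : Fin (d + 1) → ℤ), Literature.Probability.LatticeModels.Torus.proj Lc x ≠ 0 →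
      ∀ (z : Fin (d + 1) → ℤ) (ρ μ : Fin (d + 1)), G 0 x z (Sum.inr ρ) (Sum.inr μ) = 0)
    {r : Fin (d + 1) → ℕ} (ξ : ℝ)
    (hEX : ∀ y : Fin (d + 1) → ℤ, comp E (diagK (ξ • ∑ v ∈ box (d + 1) Lc, legInd (toSite r) ((Lc : ℤ) • y + toSite v))) =
      comp (diagK (ξ • ∑ v ∈ box (d + 1) Lc, legInd (toSite r) ((Lc : ℤ) • y + toSite v))) E)
    (hD : ∀ y : Fin (d + 1) → ℤ, divV (dM (G 0) Lc (SpureRecOf d Lc V H G cE cVH cΛ 0) (M 0)) y =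
      conjV 𝕄 (diagK (ξ • ∑ v ∈ box (d + 1) Lc, legInd (toSite r) ((Lc : ℤ) • y + toSite v))))
    -- the row parities of the level-0 first-order tables
    (hSp : ∀ (κ : Fin (d + 1)) (u : Fin (d + 1) → ℤ), trK (SpureRecOf d Lc V H G cE cVH cΛ 0 κ u) = -sgnK (SpureRecOf d Lc V H G cE cVH cΛ 0 κ u))
    (hMp : ∀ (ρ : Fin (d + 1)) (w : Fin (d + 1) → ℤ), trK (M 0 ρ w) = -sgnK (M 0 ρ w))
    -- the level-0 LETTERS' remainders, their classes (one rate) and row parities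
    {RW RW'' RB RB'' : (Fin (d + 1) → ℤ) → Fin (d + 1) → (Fin (d + 1) → ℤ) → MKer (d + 1) (Fib d)}
    {RM : (Fin (d + 1) → ℤ) → Fin (d + 1) → (Fin (d + 1) → ℤ) → MKer (d + 1) (Fib d)}
    (hcls0 : ∃ C δ : ℝ, 0 < δ ∧ (∀ Y, LocStencil (RW Y) C δ) ∧ (∀ Y, LocStencil (RW'' Y) C δ) ∧ (∀ Y, LocStencil (RB Y) C δ) ∧
      (∀ Y, LocStencil (RB'' Y) C δ) ∧ (∀ y, VertexFamily (RM y) Lc C δ))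
    (hRWp : ∀ Y κ u, trK (RW Y κ u) = -sgnK (RW Y κ u)) (hRW''p : ∀ Y κ u, trK (RW'' Y κ u) = -sgnK (RW'' Y κ u))
    (hRBp : ∀ Y κ u, trK (RB Y κ u) = -sgnK (RB Y κ u)) (hRB''p : ∀ Y κ u, trK (RB'' Y κ u) = -sgnK (RB'' Y κ u))
    (hRMp : ∀ y ρ' w, trK (RM y ρ' w) = -sgnK (RM y ρ' w))
    -- the level-0 LETTERS
    (hWil : ∀ (Y : Fin (d + 1) → ℤ) (κ' : Fin (d + 1)) (u' : Fin (d + 1) → ℤ),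
      cH • ∑ v ∈ box (d + 1) Lc, divV (fun κ u => cE₂ • wilsonW₂ d T κ u κ' u') ((Lc : ℤ) • Y + toSite v) =
        comp (cE • wilsonA d κ' u') (diagK (ξ • ∑ v ∈ box (d + 1) Lc, legInd (toSite r) ((Lc : ℤ) • Y + toSite v))) - comp (diagK (ξ • ∑ v ∈ box (d + 1) Lc, legInd (toSite r) ((Lc : ℤ) • Y + toSite v))) (cE • wilsonA d κ' u') + RW Y κ' u')
    (hWil'' : ∀ (Y : Fin (d + 1) → ℤ) (κ : Fin (d + 1)) (u : Fin (d + 1) → ℤ),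
      cH • ∑ v ∈ box (d + 1) Lc, divV (fun κ' u' => cE₂ • wilsonW₂ d T κ u κ' u') ((Lc : ℤ) • Y + toSite v) =
        comp (cE • wilsonA d κ u) (diagK (ξ • ∑ v ∈ box (d + 1) Lc, legInd (toSite r) ((Lc : ℤ) • Y + toSite v))) - comp (diagK (ξ • ∑ v ∈ box (d + 1) Lc, legInd (toSite r) ((Lc : ℤ) • Y + toSite v))) (cE • wilsonA d κ u) + RW'' Y κ u)
    (hBord : ∀ (Y : Fin (d + 1) → ℤ) (κ' : Fin (d + 1)) (u' : Fin (d + 1) → ℤ),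
      cH • ∑ v ∈ box (d + 1) Lc, divV (fun κ u => cB • vh₂S κ u κ' u') ((Lc : ℤ) • Y + toSite v) =
        comp (cVH • V κ' u') (diagK (ξ • ∑ v ∈ box (d + 1) Lc, legInd (toSite r) ((Lc : ℤ) • Y + toSite v))) - comp (diagK (ξ • ∑ v ∈ box (d + 1) Lc, legInd (toSite r) ((Lc : ℤ) • Y + toSite v))) (cVH • V κ' u') + RB Y κ' u')
    (hBord'' : ∀ (Y : Fin (d + 1) → ℤ) (κ : Fin (d + 1)) (u : Fin (d + 1) → ℤ),
      cH • ∑ v ∈ box (d + 1) Lc, divV (fun κ' u' => cB • vh₂S κ u κ' u') ((Lc : ℤ) • Y + toSite v) =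
        comp (cVH • V κ u) (diagK (ξ • ∑ v ∈ box (d + 1) Lc, legInd (toSite r) ((Lc : ℤ) • Y + toSite v))) - comp (diagK (ξ • ∑ v ∈ box (d + 1) Lc, legInd (toSite r) ((Lc : ℤ) • Y + toSite v))) (cVH • V κ u) + RB'' Y κ u)
    (hM₂ : ∀ (y : Fin (d + 1) → ℤ) (ρ' : Fin (d + 1)) (w : Fin (d + 1) → ℤ),
      cH • ∑ v ∈ box (d + 1) Lc, divV (fun κ u => M2Of d Lc mixFF 0 κ u ρ' w) ((Lc : ℤ) • y + toSite v) =
        comp (M 0 ρ' w) (diagK (ξ • ∑ v ∈ box (d + 1) Lc, legInd (toSite r) ((Lc : ℤ) • y + toSite v))) - comp (diagK (ξ • ∑ v ∈ box (d + 1) Lc, legInd (toSite r) ((Lc : ℤ) • y + toSite v))) (M 0 ρ' w) + RM y ρ' w) :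
    ∃ Nr : (Fin (d + 1) → ℤ) → Fin (d + 1) → (Fin (d + 1) → ℤ) → MKer (d + 1) (Fib d),
      (∃ C δ : ℝ, 0 < δ ∧ ∀ y, VertexFamily (Nr y) Lc C δ) ∧
      (∀ y ν y', trK (Nr y ν y') = -sgnK (Nr y ν y')) ∧
      (∀ (y : Fin (d + 1) → ℤ) (ν : Fin (d + 1)) (y' : Fin (d + 1) → ℤ),
        divW (WrecOf d Lc G (SpureRecOf d Lc V H G cE cVH cΛ) M cE₂ cB T vh₂S mixFF 0) y ν y' =
          conjV (dM (G 0) Lc (SpureRecOf d Lc V H G cE cVH cΛ 0) (M 0) ν y') (diagK (ξ • ∑ v ∈ box (d + 1) Lc, legInd (toSite r) ((Lc : ℤ) • y + toSite v))) + Nr y ν y') := by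
  have hS : ∀ j : ℕ, ∃ Cs δ : ℝ, 0 < δ ∧ LocStencil (SpureRecOf d Lc V H G cE cVH cΛ j) Cs δ := locStencil_SpureRecOf (d := d) hLc hV hH hG cE cVH cΛ
  obtain ⟨C0, δ0, hδ0, hRWl, hRW''l, hRBl, hRB''l, hRMl⟩ := hcls0
  have hRl : ∀ Y, LocStencil (fun κ u => RW Y κ u + RB Y κ u) (C0 + C0) δ0 := fun Y => locStencil_add (hRWl Y) (hRBl Y)
  have hR''l : ∀ Y, LocStencil (fun κ u => RW'' Y κ u + RB'' Y κ u) (C0 + C0) δ0 := fun Y => locStencil_add (hRW''l Y) (hRB''l Y)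
  -- the residual: part B's, at level 0, with `R := RW + RB`, `R″ := RW″ + RB″`
  let N0 : (Fin (d + 1) → ℤ) → Fin (d + 1) → (Fin (d + 1) → ℤ) → MKer (d + 1) (Fib d) := fun y ν y' =>
    (1 / 2 : ℝ) • (
              (dM (G 0) Lc (fun κ u => RW y κ u + RB y κ u) (RM y) ν y'
                - cH • (∑ κ, wsum (fun u => ∑' x₂, ∑ κ₂,
                    comp (G 0) (dM (G 0) Lc (SpureRecOf d Lc V H G cE cVH cΛ 0) (M 0) ν y') u x₂ (Sum.inl κ) (Sum.inl κ₂) * gaugeWt Lc y κ₂ x₂) (SpureRecOf d Lc V H G cE cVH cΛ 0 κ)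
                  + ∑ ρ', cwsum Lc (fun w => ∑' x₂, ∑ κ₂,
                    comp (G 0) (dM (G 0) Lc (SpureRecOf d Lc V H G cE cVH cΛ 0) (M 0) ν y') ((Lc : ℤ) • w) x₂ (Sum.inr ρ') (Sum.inl κ₂) * gaugeWt Lc y κ₂ x₂) (M 0 ρ')))
              + (dM (G 0) Lc (fun κ u => RW'' y κ u + RB'' y κ u) (RM y) ν y'
                + dM (conjV (G 0) (diagK (ξ • ∑ v ∈ box (d + 1) Lc, legInd (toSite r) ((Lc : ℤ) • y + toSite v)))) Lc (SpureRecOf d Lc V H G cE cVH cΛ 0) (M 0) ν y'))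
  refine ⟨N0, ?_, ?_, ?_⟩
  · obtain ⟨C, δ, hδ, h⟩ := exists_vertexFamily_residual_slot (hG 0) (hS 0) (hM 0) cH r ξ
      (R := fun Y κ u => RW Y κ u + RB Y κ u) (R'' := fun Y κ u => RW'' Y κ u + RB'' Y κ u) (RM := RM) hδ0 hRl hδ0 hR''l hδ0 hRMl
    exact ⟨C, δ, hδ, fun y => h y⟩
  · intro y ν y'
    exact parityOdd_residual_slot hSp hMp cH r ξ (R := fun Y κ u => RW Y κ u + RB Y κ u)
      (R'' := fun Y κ u => RW'' Y κ u + RB'' Y κ u) (RM := RM) (fun Y κ u => parityOdd_add (hRWp Y κ u) (hRBp Y κ u))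
      (fun Y κ u => parityOdd_add (hRW''p Y κ u) (hRB''p Y κ u)) hRMp y ν y'
  · intro y ν y'
    exact divW_WrecOf_of_tableLaws hLc hG hS hM cE₂ cB T hB hmix 0 h𝕄 hE hR cH hHc hMw hoff
      (fun y => spr_blockGen (Lc := Lc) r ξ y) (fun y => loc_diagK_smul_sum_legInd Lc (toSite r) ξ y) hEX hD
      (R := fun y κ u => RW y κ u + RB y κ u) (R'' := fun y κ u => RW'' y κ u + RB'' y κ u)
      (fun Y κ u x z a b => abs_add_le' (fun x z a b => bdd_of_biLoc (hRWl Y κ u) hδ0.le x z a b)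
        (fun x z a b => bdd_of_biLoc (hRBl Y κ u) hδ0.le x z a b) x z a b)
      (fun Y κ u x z a b => abs_add_le' (fun x z a b => bdd_of_biLoc (hRW''l Y κ u) hδ0.le x z a b)
        (fun x z a b => bdd_of_biLoc (hRB''l Y κ u) hδ0.le x z a b) x z a b)
      (fun y ρ' w x z a b => bdd_of_biLoc (hRMl y ρ' w) hδ0.le x z a b)
      (fun Y κ' u' => tableLaw_T2RecOf_zero (G := G) (M := M) cE cVH cΛ cE₂ cB T vh₂S mixFF hWil hBord Y κ' u')
      (fun Y κ u => tableLaw_T2RecOf_zero'' (G := G) (M := M) cE cVH cΛ cE₂ cB T vh₂S mixFF hWil'' hBord'' Y κ u) hM₂ y ν y'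

/-! ## §2 The same in the coarse Ward END's exact W-side text: `hWd` (with `X₂ := 0`), `hNr`, `hN0` -/

/-- [folklore] **THE W-SIDE SOCKETS OF THE COARSE WARD END AT MEMBER 0, FROM THE LEVEL-0 LETTERS**: under the hypotheses of §1, the order-one consistency (c1) at member 0
and the sgn-symmetry of the level-0 chart, there is a residual `Nr` — localised, parity-odd, with VANISHING TADPOLE against `G 0` (an1's `tadpole_eq_zero_of_parity`) — such
that `divW (WrecOf … 0) y ν y′ = conjW 𝕄 0 (vertexOfK (G 0) Lc (SrecOf … 0) ν y′) (X y) 0 0 + Nr y ν y′` (`conjW_zero_zero_zero`): PART 103's `hWd` with `X₂ := 0`, `hNr`, `hN0`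
VERBATIM up to the record's names (`W = WrecOf … 0`, `S = SrecOf … 0`, `M = 𝕄`, `K = G 0`, `N = Lc`). -/
theorem exists_wardSide_zero_of_letters_slot (hLc : 1 ≤ Lc) (hV : ∀ δ : ℝ, 0 ≤ δ → ∃ C : ℝ, LocStencil V C δ)
    (hH : ∀ δ : ℝ, 0 ≤ δ → ∃ C : ℝ, VertexFamily H Lc C δ)
    (hG : ∀ j : ℕ, ∃ δ C : ℝ, 0 < δ ∧ 0 ≤ C ∧ Decays (G j) C δ) (hM : ∀ j : ℕ, ∃ CM δ : ℝ, 0 < δ ∧ VertexFamily (M j) Lc CM δ)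
    (cE cVH cΛ cE₂ cB : ℝ) (T : Fin 4 → Fin 4 → Fin 4 → Fin 4 → ℝ)
    {vh₂S : Fin (d + 1) → (Fin (d + 1) → ℤ) → Fin (d + 1) → (Fin (d + 1) → ℤ) → MKer (d + 1) (Fib d)}
    (hB : ∃ C δ : ℝ, 0 < δ ∧ LocStencil₂ vh₂S C δ)
    {mixFF : Fin (d + 1) → (Fin (d + 1) → ℤ) → Fin (d + 1) → (Fin (d + 1) → ℤ) → MKer (d + 1) (Fib d)}
    (hmix : ∃ C δ : ℝ, 0 < δ ∧ LocStencilFM Lc mixFF C δ)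
    {𝕄 E : MKer (d + 1) (Fib d)} (h𝕄 : Spr 𝕄) (hE : Spr E) (hR : RelInv (G 0) 𝕄 E) (cH : ℝ)
    (hHc : ∀ (y : Fin (d + 1) → ℤ) (κ' : Fin (d + 1)) (u : Fin (d + 1) → ℤ),
      ∑ μ, (colH (G 0) Lc μ (y - unitVec μ) κ' u - colH (G 0) Lc μ y κ' u) = cH * gaugeWt Lc y κ' u)
    (hMw : ∀ (y : Fin (d + 1) → ℤ) (ρ : Fin (d + 1)) (w : Fin (d + 1) → ℤ),
      ∑ μ, (colM (G 0) Lc μ (y - unitVec μ) ρ w - colM (G 0) Lc μ y ρ w) = 0)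
    (hoff : ∀ (x : Fin (d + 1) → ℤ), Literature.Probability.LatticeModels.Torus.proj Lc x ≠ 0 →
      ∀ (z : Fin (d + 1) → ℤ) (ρ μ : Fin (d + 1)), G 0 x z (Sum.inr ρ) (Sum.inr μ) = 0)
    {r : Fin (d + 1) → ℕ} (ξ : ℝ)
    (hEX : ∀ y : Fin (d + 1) → ℤ, comp E (diagK (ξ • ∑ v ∈ box (d + 1) Lc, legInd (toSite r) ((Lc : ℤ) • y + toSite v))) =
      comp (diagK (ξ • ∑ v ∈ box (d + 1) Lc, legInd (toSite r) ((Lc : ℤ) • y + toSite v))) E)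
    (hD : ∀ y : Fin (d + 1) → ℤ, divV (dM (G 0) Lc (SpureRecOf d Lc V H G cE cVH cΛ 0) (M 0)) y =
      conjV 𝕄 (diagK (ξ • ∑ v ∈ box (d + 1) Lc, legInd (toSite r) ((Lc : ℤ) • y + toSite v))))
    -- (c1) at member 0 and the sgn-symmetry of the level-0 chart
    (hc1 : ∀ (κ : Fin (d + 1)) (u : Fin (d + 1) → ℤ),
      dM (G 0) Lc (SpureRecOf d Lc V H G cE cVH cΛ 0) (M 0) κ u = vertexOfK (G 0) Lc (SrecOf d Lc V H G cE cVH cΛ 0) κ u)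
    (hGt : trK (G 0) = sgnK (G 0))
    (hSp : ∀ (κ : Fin (d + 1)) (u : Fin (d + 1) → ℤ), trK (SpureRecOf d Lc V H G cE cVH cΛ 0 κ u) = -sgnK (SpureRecOf d Lc V H G cE cVH cΛ 0 κ u))
    (hMp : ∀ (ρ : Fin (d + 1)) (w : Fin (d + 1) → ℤ), trK (M 0 ρ w) = -sgnK (M 0 ρ w))
    {RW RW'' RB RB'' : (Fin (d + 1) → ℤ) → Fin (d + 1) → (Fin (d + 1) → ℤ) → MKer (d + 1) (Fib d)}
    {RM : (Fin (d + 1) → ℤ) → Fin (d + 1) → (Fin (d + 1) → ℤ) → MKer (d + 1) (Fib d)}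
    (hcls0 : ∃ C δ : ℝ, 0 < δ ∧ (∀ Y, LocStencil (RW Y) C δ) ∧ (∀ Y, LocStencil (RW'' Y) C δ) ∧ (∀ Y, LocStencil (RB Y) C δ) ∧
      (∀ Y, LocStencil (RB'' Y) C δ) ∧ (∀ y, VertexFamily (RM y) Lc C δ))
    (hRWp : ∀ Y κ u, trK (RW Y κ u) = -sgnK (RW Y κ u)) (hRW''p : ∀ Y κ u, trK (RW'' Y κ u) = -sgnK (RW'' Y κ u))
    (hRBp : ∀ Y κ u, trK (RB Y κ u) = -sgnK (RB Y κ u)) (hRB''p : ∀ Y κ u, trK (RB'' Y κ u) = -sgnK (RB'' Y κ u))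
    (hRMp : ∀ y ρ' w, trK (RM y ρ' w) = -sgnK (RM y ρ' w))
    (hWil : ∀ (Y : Fin (d + 1) → ℤ) (κ' : Fin (d + 1)) (u' : Fin (d + 1) → ℤ),
      cH • ∑ v ∈ box (d + 1) Lc, divV (fun κ u => cE₂ • wilsonW₂ d T κ u κ' u') ((Lc : ℤ) • Y + toSite v) =
        comp (cE • wilsonA d κ' u') (diagK (ξ • ∑ v ∈ box (d + 1) Lc, legInd (toSite r) ((Lc : ℤ) • Y + toSite v))) - comp (diagK (ξ • ∑ v ∈ box (d + 1) Lc, legInd (toSite r) ((Lc : ℤ) • Y + toSite v))) (cE • wilsonA d κ' u') + RW Y κ' u')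
    (hWil'' : ∀ (Y : Fin (d + 1) → ℤ) (κ : Fin (d + 1)) (u : Fin (d + 1) → ℤ),
      cH • ∑ v ∈ box (d + 1) Lc, divV (fun κ' u' => cE₂ • wilsonW₂ d T κ u κ' u') ((Lc : ℤ) • Y + toSite v) =
        comp (cE • wilsonA d κ u) (diagK (ξ • ∑ v ∈ box (d + 1) Lc, legInd (toSite r) ((Lc : ℤ) • Y + toSite v))) - comp (diagK (ξ • ∑ v ∈ box (d + 1) Lc, legInd (toSite r) ((Lc : ℤ) • Y + toSite v))) (cE • wilsonA d κ u) + RW'' Y κ u)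
    (hBord : ∀ (Y : Fin (d + 1) → ℤ) (κ' : Fin (d + 1)) (u' : Fin (d + 1) → ℤ),
      cH • ∑ v ∈ box (d + 1) Lc, divV (fun κ u => cB • vh₂S κ u κ' u') ((Lc : ℤ) • Y + toSite v) =
        comp (cVH • V κ' u') (diagK (ξ • ∑ v ∈ box (d + 1) Lc, legInd (toSite r) ((Lc : ℤ) • Y + toSite v))) - comp (diagK (ξ • ∑ v ∈ box (d + 1) Lc, legInd (toSite r) ((Lc : ℤ) • Y + toSite v))) (cVH • V κ' u') + RB Y κ' u')
    (hBord'' : ∀ (Y : Fin (d + 1) → ℤ) (κ : Fin (d + 1)) (u : Fin (d + 1) → ℤ),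
      cH • ∑ v ∈ box (d + 1) Lc, divV (fun κ' u' => cB • vh₂S κ u κ' u') ((Lc : ℤ) • Y + toSite v) =
        comp (cVH • V κ u) (diagK (ξ • ∑ v ∈ box (d + 1) Lc, legInd (toSite r) ((Lc : ℤ) • Y + toSite v))) - comp (diagK (ξ • ∑ v ∈ box (d + 1) Lc, legInd (toSite r) ((Lc : ℤ) • Y + toSite v))) (cVH • V κ u) + RB'' Y κ u)
    (hM₂ : ∀ (y : Fin (d + 1) → ℤ) (ρ' : Fin (d + 1)) (w : Fin (d + 1) → ℤ),
      cH • ∑ v ∈ box (d + 1) Lc, divV (fun κ u => M2Of d Lc mixFF 0 κ u ρ' w) ((Lc : ℤ) • y + toSite v) =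
        comp (M 0 ρ' w) (diagK (ξ • ∑ v ∈ box (d + 1) Lc, legInd (toSite r) ((Lc : ℤ) • y + toSite v))) - comp (diagK (ξ • ∑ v ∈ box (d + 1) Lc, legInd (toSite r) ((Lc : ℤ) • y + toSite v))) (M 0 ρ' w) + RM y ρ' w) :
    ∃ Nr : (Fin (d + 1) → ℤ) → Fin (d + 1) → (Fin (d + 1) → ℤ) → MKer (d + 1) (Fib d),
      (∀ y ν y', Loc (Nr y ν y')) ∧
      (∀ y ν y', tadpole (G 0) (Nr y ν y') = 0) ∧
      (∀ y ν y', trK (Nr y ν y') = -sgnK (Nr y ν y')) ∧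
      (∀ (y : Fin (d + 1) → ℤ) (ν : Fin (d + 1)) (y' : Fin (d + 1) → ℤ),
        divW (WrecOf d Lc G (SpureRecOf d Lc V H G cE cVH cΛ) M cE₂ cB T vh₂S mixFF 0) y ν y' =
          conjW 𝕄 0 (vertexOfK (G 0) Lc (SrecOf d Lc V H G cE cVH cΛ 0) ν y')
              (diagK (ξ • ∑ v ∈ box (d + 1) Lc, legInd (toSite r) ((Lc : ℤ) • y + toSite v))) 0 0 + Nr y ν y') := by
  obtain ⟨Nr, ⟨C, δ, hδ, hcls⟩, hpar, hlaw⟩ := exists_kernelLaw_zero_of_letters_slot hLc hV hH hG hM cE cVH cΛ cE₂ cB T hB hmix h𝕄 hE hR cH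
    hHc hMw hoff ξ hEX hD hSp hMp hcls0 hRWp hRW''p hRBp hRB''p hRMp hWil hWil'' hBord hBord'' hM₂
  have hloc : ∀ y ν y', Loc (Nr y ν y') := fun y ν y' => ⟨_, _, _, δ, hδ, hcls y ν y'⟩
  refine ⟨Nr, hloc, fun y ν y' => tadpole_eq_zero_of_parity (spr_of_decays (hG 0)) hGt (hloc y ν y') (hpar y ν y'), hpar, fun y ν y' => ?_⟩
  rw [conjW_zero_zero_zero, ← hc1 ν y']
  exact hlaw y ν y'

end Slot

end Summit.QuantumFields.BalabanUV.Beta.WardLocusRecursiveZeroSlot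

end
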